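import Summits.Ventures.HodgeRepro.CongruenceGen
import Summits.Ventures.HodgeRepro.BallCongruenceNF
import Summits.Ventures.HodgeRepro.RealApproxUnitary
import Summits.Ventures.HodgeRepro.BallGenInvariance
import Summits.Ventures.HodgeRepro.BallGenHolo

/-!
# Lemma W for every `p` with its finite cover (seat p3)

Blind re-derivation cell `pub-hodge-repro`, seat `p3`.  Built on

* seat p5's `CongruenceGen.lean` — arithmetic and congruence subgroups of ANY `𝒢 ≤ GL_n(F)`:
  `arith 𝒢 φ = 𝒢(R)`, `congr 𝒢 φ hφ M = Γ(M)`, `conjSubG g Γ = g⁻¹ Γ g`, Hecke conjugation and the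
  «congruence» half `congr_le_inf_conjSubG`, the finite-index clause `isFiniteRelIndex_inf_conjSubG` —
  and `BallCongruenceNF.lean` (`exists_integral_multiple_of_finite`, `finite_quotient_span_of_ne_zero`,
  `Ring.HasFiniteQuotients (𝓞 K)`);
* seat typer-2's general-`p` model `U(p,1) = U p ≤ GL(Idx p, ℂ)` (`BallGen.lean`), its iterated Lemma W
  `lemmaW_iter` (`BallGenLemmaW.lean`) and PROVED real approximation `dense_ratPoints`
  (`RealApproxUnitary.lean`: the `K`-points `ratPoints K p φ₀ = embU φ₀ (UK K p)` are dense in `U(p,1)`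
  for every CM field `K`);
* seat p5's invariance bookkeeping `BallGenInvariance.lean` (`Inv.topForm`, `Inv.conjSub`,
  `Inv.IsInvariant`, `Inv.IsInvariantTop`, `exists_invariantTop_topForm_ne_zero`) and identity principle
  `BallGenHolo.lean` (`Holo.lemmaW_generic`: for analytic fields the full-rank locus of the translates is
  open and dense).

ROUTE.md Appendix A4, «Iteration (R5)»: «apply the claim successively … to get `g₂, …, g_g ∈ G(ℚ)` with
`ω₁ ∧ g₂^*ω₂ ∧ ⋯ ∧ g_g^*ω_g ≢ 0` on `B^p`, invariant under `Γ″ = Γ′ ∩ ⋂ᵢ gᵢ⁻¹ Γ′ gᵢ`» (congruence, finite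
index) — R5 needs `p = max(3k, g) ≥ 3`, beyond the sealed 2-ball.  Contents:

* **the number-field layer of `CongruenceGen` for `K`-points** (any `𝒢 ≤ GL_n(F)`, `σ : K → F`, `K` a
  number field): `exists_denominator` (every `g ∈ 𝒢(K) = arith 𝒢 σ` has `N·g`, `N·g⁻¹` integral over
  `𝓞 K`, `N ≠ 0`), `exists_congr_le_inf_conjSubG` (`Γ′ ⊓ g⁻¹ Γ′ g` is a congruence subgroup),
  `exists_congr_le_inf_iInf_conjSubG` (finitely many `g₁, …, g_k ∈ 𝒢(K)`: `Γ′ ⊓ ⨅ᵢ gᵢ⁻¹ Γ′ gᵢ ⊇ Γ(L)` for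
  the common level `L = M · ∏ᵢ Nᵢ²`), `isFiniteRelIndex_inf_iInf_conjSubG` (**the iterated finite
  index**: `Γ′ ⊓ ⨅ᵢ gᵢ⁻¹ Γ′ gᵢ` has finite index in `Γ′`);
* `ratPoints_le_arith` — typer-2's `K`-points are the `K`-points `arith (U p) φ₀` of `CongruenceGen`;
* **`lemmaW_iter_finiteCover`** — for every `p`, every CM field `φ₀ : K ↪ ℂ`, every congruence subgroup
  `Γ(M) ≤ Γ′ ≤ U(p,1)(𝓞 K)` (`M ≠ 0`) and `p` continuous `Γ′`-invariant cotangent fields `ω₁, …, ω_p ≢ 0`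
  on the `p`-ball, there are `K`-rational `γ₁, …, γ_p ∈ ratPoints K p φ₀` such that the `(p,0)`-form
  `⋀ᵢ γᵢ^*ωᵢ` is NOT identically zero, is invariant under `Γ″ = Γ′ ⊓ ⨅ᵢ γᵢ⁻¹ Γ′ γᵢ`, and `Γ″` contains a
  principal congruence subgroup `Γ(L)`, `L ≠ 0`, and has finite index in `Γ′`.  No density hypothesis and
  no unproved input anywhere in the chain;
* **`lemmaW_iter_finiteCover_le`** — R5's literal shape `g ≤ p` (`g = Σⱼ mⱼ dim Bⱼ`): for `g ≤ p`
  continuous `Γ′`-invariant fields `ω₁, …, ω_g ≢ 0`, `K`-rational `γ₁, …, γ_g` whose translated covectors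
  `(γᵢ^*ωᵢ)(z)` are linearly independent at some point, each `γᵢ^*ωᵢ` invariant under
  `Γ″ = Γ′ ⊓ ⨅ᵢ γᵢ⁻¹ Γ′ γᵢ`, and `Γ″` a congruence subgroup of finite index in `Γ′`;
* **`lemmaW_iter_finiteCover_holo`** — the same for ANALYTIC fields `F₁, …, F_p` (p5's `BallGenHolo`
  vocabulary) with `Γ′`-invariant restrictions: the non-vanishing locus `{z | (⋀ᵢ γᵢ^*Fᵢ)(z) ≠ 0}` is OPEN
  and DENSE in the ball — R5's «rank `g` generically» on the finite cover, for every `p`.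

What is NOT here: the passage from fields on the ball to cohomology classes of the compact quotient
`Γ″\B^p` (A4's last sentence) and the transport to an arbitrary Hermitian form (seat p5's
`CongruenceHermitian.lean`).

Nothing here says anything about the status of the Hodge conjecture for CM abelian varieties, which is
NOT proved.
-/

set_option autoImplicit false

noncomputable section

universe u

namespace HodgeRepro.BallGen

namespace Cover

open Matrix NumberField
open Summit.Ventures.HodgeRepro.CongGen
open HodgeRepro.BallGen.RealApprox (dense_ratPoints)

/-! ### The number-field layer of `CongruenceGen`: `K`-points, denominators, the iterated `Γ″` -/

section numberField

variable {n : Type} [Fintype n] [DecidableEq n] {F : Type u} [CommRing F] (𝒢 : Subgroup (GL n F))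
  (K : Type) [Field K] [NumberField K] (σ : K →+* F)

/-- The embedding `𝓞 K →+* F` induced by `σ : K →+* F`. -/
abbrev σ𝓞 : 𝓞 K →+* F := σ.comp (algebraMap (𝓞 K) K)

omit [NumberField K] in
/-- `σ𝓞` is injective when `σ` is. -/
theorem σ𝓞_injective (hσ : Function.Injective σ) : Function.Injective (σ𝓞 K σ) :=
  hσ.comp RingOfIntegers.coe_injective

omit [NumberField K] in
/-- `σ𝓞` unfolded. -/
theorem σ𝓞_apply (x : 𝓞 K) : σ𝓞 K σ x = σ (algebraMap (𝓞 K) K x) := rfl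

omit [NumberField K] in
/-- `𝒢(𝓞 K) ≤ 𝒢(K)`. -/
theorem arith_σ𝓞_le_arith : arith 𝒢 (σ𝓞 K σ) ≤ arith 𝒢 σ := by
  intro g hg
  obtain ⟨u, hu⟩ := (mem_arith 𝒢 _).mp hg
  refine (mem_arith 𝒢 σ).mpr ⟨Units.map (algebraMap (𝓞 K) K).mapMatrix.toMonoidHom u, ?_⟩
  rw [← hu]
  apply Units.ext
  rw [coe_ι, coe_ι]
  ext i j
  simp [Matrix.map_apply]

/-- **Common denominators.**  Every `K`-point `g ∈ 𝒢(K)` has `N · g` and `N · g⁻¹` integral over `𝓞 K`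
for some `N ∈ 𝓞 K ∖ {0}`: `σ A = N • matG g`, `σ B = N • matG g⁻¹` with `A, B ∈ M_n(𝓞 K)`. -/
theorem exists_denominator {g : 𝒢} (hg : g ∈ arith 𝒢 σ) :
    ∃ N : 𝓞 K, N ≠ 0 ∧ ∃ A B : Matrix n n (𝓞 K),
      Mφ (σ𝓞 K σ) A = σ𝓞 K σ N • matG 𝒢 g ∧ Mφ (σ𝓞 K σ) B = σ𝓞 K σ N • matG 𝒢 g⁻¹ := by
  obtain ⟨u, hu⟩ := (mem_arith 𝒢 σ).mp hg
  have hmat : matG 𝒢 g = Mφ σ (u : Matrix n n K) := by rw [← coe_ι, hu]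
  have hmat' : matG 𝒢 g⁻¹ = Mφ σ ((u⁻¹ : (Matrix n n K)ˣ) : Matrix n n K) := by
    rw [← coe_ι, map_inv, hu]
    rfl
  obtain ⟨N, hN, r, hr⟩ := Summit.Ventures.HodgeRepro.BallCong.exists_integral_multiple_of_finite K
    (Sum.elim (fun q : n × n => (u : Matrix n n K) q.1 q.2)
      fun q : n × n => ((u⁻¹ : (Matrix n n K)ˣ) : Matrix n n K) q.1 q.2)
  refine ⟨N, hN, Matrix.of fun i j => r (Sum.inl (i, j)), Matrix.of fun i j => r (Sum.inr (i, j)),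
    ?_, ?_⟩
  · ext i j
    rw [hmat]
    simp only [RingHom.mapMatrix_apply, Matrix.map_apply, Matrix.of_apply, Matrix.smul_apply,
      smul_eq_mul, σ𝓞_apply, hr, Sum.elim_inl, map_mul]
  · ext i j
    rw [hmat']
    simp only [RingHom.mapMatrix_apply, Matrix.map_apply, Matrix.of_apply, Matrix.smul_apply,
      smul_eq_mul, σ𝓞_apply, hr, Sum.elim_inr, map_mul]

variable (hσ : Function.Injective σ)

/-- **`Γ′ ⊓ g⁻¹ Γ′ g` is a congruence subgroup** for `g ∈ 𝒢(K)`: it contains `Γ(N² M)` for a denominator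
`N ≠ 0` of `g` (the «congruence» half of A4's «`Γ″` (congruence, finite index)»). -/
theorem exists_congr_le_inf_conjSubG {Γ' : Subgroup 𝒢} {M : 𝓞 K} (hM0 : M ≠ 0)
    (hM : congr 𝒢 (σ𝓞 K σ) (σ𝓞_injective K σ hσ) M ≤ Γ') {g : 𝒢} (hg : g ∈ arith 𝒢 σ) :
    ∃ L : 𝓞 K, L ≠ 0 ∧ congr 𝒢 (σ𝓞 K σ) (σ𝓞_injective K σ hσ) L ≤ Γ' ⊓ conjSubG g Γ' := by
  obtain ⟨N, hN, A, B, hA, hB⟩ := exists_denominator 𝒢 K σ hg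
  exact ⟨N ^ 2 * M, mul_ne_zero (pow_ne_zero 2 hN) hM0,
    congr_le_inf_conjSubG 𝒢 (σ𝓞 K σ) (σ𝓞_injective K σ hσ) hM g A B hA hB⟩

/-- **The finite-index clause of A4 for `𝒢(K)`** (generic form of p5's
`BallCong.isFiniteRelIndex_inf_conjSub_numberField`): `Γ(M) ≤ Γ′ ≤ 𝒢(𝓞 K)`, `M ≠ 0`, `g ∈ 𝒢(K)` ⇒
`Γ′ ⊓ g⁻¹ Γ′ g` has finite index in `Γ′`. -/
theorem isFiniteRelIndex_inf_conjSubG_of_mem_arith {Γ' : Subgroup 𝒢} (hΓ : Γ' ≤ arith 𝒢 (σ𝓞 K σ))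
    {M : 𝓞 K} (hM0 : M ≠ 0) (hM : congr 𝒢 (σ𝓞 K σ) (σ𝓞_injective K σ hσ) M ≤ Γ') {g : 𝒢}
    (hg : g ∈ arith 𝒢 σ) : (Γ' ⊓ conjSubG g Γ').IsFiniteRelIndex Γ' := by
  obtain ⟨N, hN, A, B, hA, hB⟩ := exists_denominator 𝒢 K σ hg
  haveI : Finite (𝓞 K ⧸ Ideal.span {N ^ 2 * M}) :=
    Summit.Ventures.HodgeRepro.BallCong.finite_quotient_span_of_ne_zero
      (mul_ne_zero (pow_ne_zero 2 hN) hM0)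
  exact isFiniteRelIndex_inf_conjSubG 𝒢 (σ𝓞 K σ) (σ𝓞_injective K σ hσ) hΓ hM g A B hA hB

/-- **Finitely many Hecke elements: a common congruence level.**  For `g₁, …, g_k ∈ 𝒢(K)` (a finite
index type) and `Γ(M) ≤ Γ′`, `M ≠ 0`, the iterated `Γ″ = Γ′ ⊓ ⨅ᵢ gᵢ⁻¹ Γ′ gᵢ` contains the principal
congruence subgroup of the common level `L = M · ∏ᵢ Nᵢ² ≠ 0` (`Nᵢ` a denominator of `gᵢ`). -/
theorem exists_congr_le_inf_iInf_conjSubG {Γ' : Subgroup 𝒢} {M : 𝓞 K} (hM0 : M ≠ 0)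
    (hM : congr 𝒢 (σ𝓞 K σ) (σ𝓞_injective K σ hσ) M ≤ Γ') {ι : Type*} [Finite ι] {g : ι → 𝒢}
    (hg : ∀ i, g i ∈ arith 𝒢 σ) :
    ∃ L : 𝓞 K, L ≠ 0 ∧ congr 𝒢 (σ𝓞 K σ) (σ𝓞_injective K σ hσ) L ≤ Γ' ⊓ ⨅ i, conjSubG (g i) Γ' := by
  cases nonempty_fintype ι
  choose N hN A B hA hB using fun i => exists_denominator 𝒢 K σ (hg i)
  refine ⟨M * ∏ i, N i ^ 2, mul_ne_zero hM0 (Finset.prod_ne_zero_iff.2 fun i _ => pow_ne_zero 2 (hN i)),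
    le_inf ((congr_le_congr_of_dvd _ _ _ (Dvd.intro _ rfl)).trans hM) (le_iInf fun i => ?_)⟩
  have hdvd : N i ^ 2 * M ∣ M * ∏ j, N j ^ 2 := by
    rw [mul_comm (N i ^ 2) M]
    exact mul_dvd_mul_left M (Finset.dvd_prod_of_mem _ (Finset.mem_univ i))
  exact (congr_le_congr_of_dvd _ _ _ hdvd).trans
    ((congr_le_inf_conjSubG 𝒢 (σ𝓞 K σ) (σ𝓞_injective K σ hσ) hM (g i) (A i) (B i) (hA i)
      (hB i)).trans inf_le_right)

/-- **The iterated finite-index clause** (A4's `Γ″ = Γ′ ∩ ⋂ᵢ gᵢ⁻¹ Γ′ gᵢ`): for `g₁, …, g_k ∈ 𝒢(K)` and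
`Γ(M) ≤ Γ′ ≤ 𝒢(𝓞 K)`, `M ≠ 0`, the subgroup `Γ′ ⊓ ⨅ᵢ gᵢ⁻¹ Γ′ gᵢ` has finite index in `Γ′` (it contains
`Γ(L)`, of finite index in `𝒢(𝓞 K)`). -/
theorem isFiniteRelIndex_inf_iInf_conjSubG {Γ' : Subgroup 𝒢} (hΓ : Γ' ≤ arith 𝒢 (σ𝓞 K σ)) {M : 𝓞 K}
    (hM0 : M ≠ 0) (hM : congr 𝒢 (σ𝓞 K σ) (σ𝓞_injective K σ hσ) M ≤ Γ') {ι : Type*} [Finite ι]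
    {g : ι → 𝒢} (hg : ∀ i, g i ∈ arith 𝒢 σ) :
    (Γ' ⊓ ⨅ i, conjSubG (g i) Γ').IsFiniteRelIndex Γ' := by
  obtain ⟨L, hL, hle⟩ := exists_congr_le_inf_iInf_conjSubG 𝒢 K σ hσ hM0 hM hg
  haveI : Finite (𝓞 K ⧸ Ideal.span {L}) :=
    Summit.Ventures.HodgeRepro.BallCong.finite_quotient_span_of_ne_zero hL
  haveI : (congr 𝒢 (σ𝓞 K σ) (σ𝓞_injective K σ hσ) L).IsFiniteRelIndex (arith 𝒢 (σ𝓞 K σ)) :=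
    isFiniteRelIndex_congr 𝒢 _ _ L
  haveI : (congr 𝒢 (σ𝓞 K σ) (σ𝓞_injective K σ hσ) L).IsFiniteRelIndex Γ' :=
    Subgroup.isFiniteRelIndex_of_le_right _ hΓ
  exact Subgroup.isFiniteRelIndex_of_le_left Γ' hle

end numberField

/-! ### `U(p,1)`: typer-2's `K`-points are `CongruenceGen`'s, and Lemma W with its finite cover -/

section ball

variable {p : ℕ} {K : Type} [Field K] [NumberField K] [IsCMField K]

/-- p5's conjugate subgroup on `U p` is `CongruenceGen`'s. -/
theorem conjSub_eq (g : U p) (Γ : Subgroup (U p)) : Inv.conjSub g Γ = conjSubG g Γ := rfl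

/-- `embU φ₀ u` is the image of the invertible `K`-matrix `u`: a `K`-point of `U(p,1)`. -/
theorem embU_mem_arith (φ₀ : K →+* ℂ) (u : UK K p) : embU φ₀ u ∈ arith (U p) φ₀ :=
  ⟨(u : GL (Idx p) K), rfl⟩

/-- `ratPoints K p φ₀ ≤ arith (U p) φ₀`: typer-2's `K`-points are `K`-points in `CongruenceGen`'s sense
(matrix and inverse matrix with entries in `φ₀(K)`). -/
theorem ratPoints_le_arith (φ₀ : K →+* ℂ) : ratPoints K p φ₀ ≤ arith (U p) φ₀ := by
  intro γ hγ
  obtain ⟨u, rfl⟩ := (mem_ratPoints φ₀ γ).1 hγ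
  exact embU_mem_arith φ₀ u

/-- **Lemma W for every `p` with its finite cover (ROUTE.md A4, «Iteration (R5)»).**  Let `K` be a CM
field, `φ₀ : K ↪ ℂ`, and `Γ′` a congruence subgroup of `U(p,1)(𝓞 K)`: `Γ(M) ≤ Γ′ ≤ U(p,1)(𝓞 K)`, `M ≠ 0`.
For `p` continuous `Γ′`-invariant cotangent fields `ω₁, …, ω_p` on the `p`-ball, none identically zero,
there are `K`-rational Hecke elements `γ₁, …, γ_p ∈ ratPoints K p φ₀` with: the `(p,0)`-form
`⋀ᵢ γᵢ^*ωᵢ` is not identically zero; it is invariant under `Γ″ := Γ′ ⊓ ⨅ᵢ γᵢ⁻¹ Γ′ γᵢ`; `Γ″` contains a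
principal congruence subgroup `Γ(L)`, `L ≠ 0`; and `Γ″` has finite index in `Γ′`. -/
theorem lemmaW_iter_finiteCover (φ₀ : K →+* ℂ) {Γ' : Subgroup (U p)}
    (hΓ : Γ' ≤ arith (U p) (σ𝓞 K φ₀)) {M : 𝓞 K} (hM0 : M ≠ 0)
    (hM : congr (U p) (σ𝓞 K φ₀) (σ𝓞_injective K φ₀ φ₀.injective) M ≤ Γ')
    (ω : Fin p → Ball p → Fin p → ℂ) (hc : ∀ j, Continuous (ω j)) (h0 : ∀ j, ∃ w, ω j w ≠ 0)
    (hinv : ∀ j, Inv.IsInvariant Γ' (ω j)) :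
    ∃ γ : Fin p → U p, (∀ j, γ j ∈ ratPoints K p φ₀) ∧
      (Inv.topForm fun i => pullback (γ i) (ω i)) ≠ 0 ∧
      Inv.IsInvariantTop (Γ' ⊓ ⨅ i, Inv.conjSub (γ i) Γ') (Inv.topForm fun i => pullback (γ i) (ω i)) ∧
      (∃ L : 𝓞 K, L ≠ 0 ∧
        congr (U p) (σ𝓞 K φ₀) (σ𝓞_injective K φ₀ φ₀.injective) L ≤
          Γ' ⊓ ⨅ i, Inv.conjSub (γ i) Γ') ∧
      (Γ' ⊓ ⨅ i, Inv.conjSub (γ i) Γ').IsFiniteRelIndex Γ' := by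
  obtain ⟨γ, hγ, z, hli⟩ := lemmaW_iter (dense_ratPoints φ₀) p le_rfl ω hc h0
  obtain ⟨hinvTop, hne⟩ := Inv.exists_invariantTop_topForm_ne_zero hinv γ hli
  have hrat : ∀ i, γ i ∈ arith (U p) φ₀ := fun i => ratPoints_le_arith φ₀ (hγ i)
  refine ⟨γ, hγ, hne, hinvTop.mono inf_le_right, ?_, ?_⟩
  · exact exists_congr_le_inf_iInf_conjSubG (U p) K φ₀ φ₀.injective hM0 hM hrat
  · exact isFiniteRelIndex_inf_iInf_conjSubG (U p) K φ₀ φ₀.injective hΓ hM0 hM hrat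

/-- **Lemma W for every `p` with its finite cover, `g ≤ p` forms (R5's literal shape).**  Let `Γ(M) ≤ Γ′ ≤
`U(p,1)(𝓞 K)`, `M ≠ 0`, and let `ω₁, …, ω_g`, `g ≤ p`, be continuous `Γ′`-invariant cotangent fields on the
`p`-ball, none identically zero.  Then there are `K`-rational `γ₁, …, γ_g ∈ ratPoints K p φ₀` and a point `z`
at which the translated covectors `(γᵢ^*ωᵢ)(z)` are linearly independent; every translate `γᵢ^*ωᵢ` is
invariant under `Γ″ := Γ′ ⊓ ⨅ᵢ γᵢ⁻¹ Γ′ γᵢ`, and `Γ″` contains a principal congruence subgroup `Γ(L)`,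
`L ≠ 0`, and has finite index in `Γ′`. -/
theorem lemmaW_iter_finiteCover_le (φ₀ : K →+* ℂ) {Γ' : Subgroup (U p)}
    (hΓ : Γ' ≤ arith (U p) (σ𝓞 K φ₀)) {M : 𝓞 K} (hM0 : M ≠ 0)
    (hM : congr (U p) (σ𝓞 K φ₀) (σ𝓞_injective K φ₀ φ₀.injective) M ≤ Γ') {g : ℕ} (hg : g ≤ p)
    (ω : Fin g → Ball p → Fin p → ℂ) (hc : ∀ j, Continuous (ω j)) (h0 : ∀ j, ∃ w, ω j w ≠ 0)
    (hinv : ∀ j, Inv.IsInvariant Γ' (ω j)) :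
    ∃ γ : Fin g → U p, (∀ j, γ j ∈ ratPoints K p φ₀) ∧
      (∃ z : Ball p, LinearIndependent ℂ fun j => pullback (γ j) (ω j) z) ∧
      (∀ j, Inv.IsInvariant (Γ' ⊓ ⨅ i, Inv.conjSub (γ i) Γ') (pullback (γ j) (ω j))) ∧
      (∃ L : 𝓞 K, L ≠ 0 ∧
        congr (U p) (σ𝓞 K φ₀) (σ𝓞_injective K φ₀ φ₀.injective) L ≤
          Γ' ⊓ ⨅ i, Inv.conjSub (γ i) Γ') ∧
      (Γ' ⊓ ⨅ i, Inv.conjSub (γ i) Γ').IsFiniteRelIndex Γ' := by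
  obtain ⟨γ, hγ, z, hli⟩ := lemmaW_iter (dense_ratPoints φ₀) g hg ω hc h0
  have hrat : ∀ i, γ i ∈ arith (U p) φ₀ := fun i => ratPoints_le_arith φ₀ (hγ i)
  refine ⟨γ, hγ, ⟨z, hli⟩, fun j => (Inv.isInvariant_pullback_conj (hinv j) (γ j)).mono
    (inf_le_right.trans (iInf_le _ j)), ?_, ?_⟩
  · exact exists_congr_le_inf_iInf_conjSubG (U p) K φ₀ φ₀.injective hM0 hM hrat
  · exact isFiniteRelIndex_inf_iInf_conjSubG (U p) K φ₀ φ₀.injective hΓ hM0 hM hrat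

/-- **Lemma W for every `p` with its finite cover, holomorphic form.**  For `p` ANALYTIC fields
`F₁, …, F_p` on the `p`-ball (analytic on a neighbourhood of `ballSet p`, not identically zero on the ball)
whose restrictions to the ball are `Γ′`-invariant, `Γ(M) ≤ Γ′ ≤ U(p,1)(𝓞 K)`, `M ≠ 0`, there are `K`-rational
`γ₁, …, γ_p ∈ ratPoints K p φ₀` such that the `(p,0)`-form `⋀ᵢ γᵢ^*Fᵢ` is non-zero on an OPEN DENSE set of
the ball (identity principle), is invariant under `Γ″ := Γ′ ⊓ ⨅ᵢ γᵢ⁻¹ Γ′ γᵢ`, and `Γ″` contains a principal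
congruence subgroup `Γ(L)`, `L ≠ 0`, and has finite index in `Γ′`. -/
theorem lemmaW_iter_finiteCover_holo (φ₀ : K →+* ℂ) {Γ' : Subgroup (U p)}
    (hΓ : Γ' ≤ arith (U p) (σ𝓞 K φ₀)) {M : 𝓞 K} (hM0 : M ≠ 0)
    (hM : congr (U p) (σ𝓞 K φ₀) (σ𝓞_injective K φ₀ φ₀.injective) M ≤ Γ')
    {F : Fin p → (Fin p → ℂ) → (Fin p → ℂ)} (hF : ∀ i, AnalyticOnNhd ℂ (F i) (Holo.ballSet p))
    (hF0 : ∀ i, ∃ w : Ball p, F i w.1 ≠ 0)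
    (hinv : ∀ i, Inv.IsInvariant Γ' fun w : Ball p => F i w.1) :
    ∃ γ : Fin p → U p, (∀ j, γ j ∈ ratPoints K p φ₀) ∧
      IsOpen {z : Ball p | (Inv.topForm fun i => pullback (γ i) fun w : Ball p => F i w.1) z ≠ 0} ∧
      Dense {z : Ball p | (Inv.topForm fun i => pullback (γ i) fun w : Ball p => F i w.1) z ≠ 0} ∧
      Inv.IsInvariantTop (Γ' ⊓ ⨅ i, Inv.conjSub (γ i) Γ')
        (Inv.topForm fun i => pullback (γ i) fun w : Ball p => F i w.1) ∧
      (∃ L : 𝓞 K, L ≠ 0 ∧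
        congr (U p) (σ𝓞 K φ₀) (σ𝓞_injective K φ₀ φ₀.injective) L ≤
          Γ' ⊓ ⨅ i, Inv.conjSub (γ i) Γ') ∧
      (Γ' ⊓ ⨅ i, Inv.conjSub (γ i) Γ').IsFiniteRelIndex Γ' := by
  obtain ⟨γ, hγ, hopen, hdense⟩ := Holo.lemmaW_generic (dense_ratPoints φ₀) hF hF0
  have hset : {z : Ball p | (Inv.topForm fun i => pullback (γ i) fun w : Ball p => F i w.1) z ≠ 0} =
      {z : Ball p | LinearIndependent ℂ fun i => pullback (γ i) (fun w : Ball p => F i w.1) z} := by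
    ext z
    exact Inv.topForm_ne_zero_iff_linearIndependent _ z
  have hrat : ∀ i, γ i ∈ arith (U p) φ₀ := fun i => ratPoints_le_arith φ₀ (hγ i)
  refine ⟨γ, hγ, hset ▸ hopen, hset ▸ hdense,
    (Inv.isInvariantTop_topForm_pullback hinv γ).mono inf_le_right, ?_, ?_⟩
  · exact exists_congr_le_inf_iInf_conjSubG (U p) K φ₀ φ₀.injective hM0 hM hrat
  · exact isFiniteRelIndex_inf_iInf_conjSubG (U p) K φ₀ φ₀.injective hΓ hM0 hM hrat

end ball

end Cover

end HodgeRepro.BallGen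

end
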